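import Literature.NumberTheory.LFunctions.RayClassLogFreeSieveSide
import Literature.NumberTheory.LFunctions.ClassGroupLogFreeMiddleRange
import HarnessLib

/-!
# Bombieri's Théorème 14 for the characters of a congruence class group `mod 𝔪`, III: the middle range

Topic `Literature/NumberTheory/LFunctions`, namespace `Literature.NumberTheory.LFunctions.AbelianDensity`.
Everything here is PROVED (theorems only; no definitions, no named facts).

The ray-class counterpart of the tree's `ClassGroupLogFreeMiddleRangeAllDegrees.middleRange_CG_of_le` (conductor
`1`), for the Hecke `L`-functions `L_ψ` (`datumL`) of the non-trivial characters `ψ` of a congruence class group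
modulo `𝔪` (an abelian Frobenius datum `f` killing the narrow ray `mod 𝔪`, non-trivial characters non-principal on
the primes `∤ 𝔪`): Bombieri's Théorème 14 (pp. 48–50) with the log-free mean value theorem for Hecke characters
(`sieveSide_congruence`, Thorner–Zaman Thm 4.1 / Weiss Thm 4.2) in place of Théorème 11, the all-degree zero side
`zeroSide_rayClass_of_le`, the wide kernel `A = (n+2)T'` and the packaged saving
`card_mul_rayMeanValueConst_wide_le_param` (sieve parameter `z = ⌊N_X^{1/(2n+4)}⌋ ≥ P ≥ N𝔪`, so that the
sifted ideals are prime to `𝔪` and the sifted sums of the primitive associates are the sieve-side sums,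
`summatory_coefSiftedB_eq_sum_normIdeals`):
* `middleRange_congruence_of_le (n)` — for every `c₀ > 0` there are `δ₀, A, C > 0` depending only on `n, c₀`
  such that for every `K` with `n_K ≤ n`, every such datum `mod 𝔪`, every `P ≥ 2` with `|d_K| ≤ P`, `N𝔪 ≤ P`,
  `|G| ≤ P`, `κ_K ≥ 1/P`, all finite sets `Z(ψ)` of zeros of `L_ψ` in `0 < β < 1`, `|γ| ≤ P`, and
  `c₀/log P ≤ 1 − α ≤ δ₀`: `Σ_{ψ ≠ 0} Σ_{ρ ∈ Z(ψ), β ≥ α} m(ρ) ≤ C P^{A(1−α)}`.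

## References
* [Bombieri1987GrandCrible] E. Bombieri, Astérisque 18 (1987), §6 Théorème 14, pp. 48–50.
* [ThornerZaman2017] J. Thorner, A. Zaman, Algebra Number Theory 11 (2017), Theorem 4.1, §5.
* [Weiss1983] A. Weiss, J. reine angew. Math. 338 (1983) 56–94, Thm. 4.3.
-/

noncomputable section

open Complex Finset Filter Real MeasureTheory NumberField IsDedekindDomain
open scoped LSeries.notation ArithmeticFunction.vonMangoldt Topology Nat NumberField

namespace Literature.NumberTheory.LFunctions.AbelianDensity

open Literature.NumberTheory.LFunctions.LogFreeLocal Literature.NumberTheory.LFunctions.LogFreeDensity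
  Literature.NumberTheory.LFunctions.NumberField Literature.NumberTheory.LFunctions.WeissKernel
open scoped nonZeroDivisors

set_option maxHeartbeats 1600000 in
open scoped Classical in
/-- **Théorème 14 for a congruence class group `mod 𝔪` in the middle range, every degree** (Bombieri pp. 48–50
with the log-free mean value theorem for Hecke characters in place of Théorème 11, wide kernel `A = (n+2)T'`, sieve
parameter `z = ⌊N_X^{1/(2n+4)}⌋`): for every `n` and `c₀ > 0` there are `δ₀, A, C > 0` (depending on `n, c₀` only)
such that for every number field `K` with `n_K ≤ n`, every abelian Frobenius datum `f` killing the narrow ray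
`mod 𝔪 ≠ 0` with non-trivial characters non-principal on the primes `∤ 𝔪`, every `P ≥ 2` with `|d_K| ≤ P`,
`N𝔪 ≤ P`, `|G| ≤ P`, `κ_K ≥ 1/P`, all finite sets `Z(ψ)` of zeros of `L_ψ` in `0 < β < 1`, `|γ| ≤ P`, and
`c₀/log P ≤ 1 − α ≤ δ₀`: `Σ_{ψ ≠ 0} Σ_{ρ ∈ Z(ψ), β ≥ α} m(ρ) ≤ C P^{A(1−α)}`. [cite: Bombieri1987GrandCrible, §6 Théorème 14] -/
theorem middleRange_congruence_of_le (n : ℕ) {c₀ : ℝ} (hc₀ : 0 < c₀) :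
    ∃ δ₀ A C : ℝ, 0 < δ₀ ∧ 0 < A ∧ 0 < C ∧
      ∀ (K : Type*) [Field K] [NumberField K], Module.finrank ℚ K ≤ n →
      ∀ (G : Type*) [CommGroup G] [Finite G] (𝔪 : Ideal (𝓞 K)) (f : HeightOneSpectrum (𝓞 K) → G)
        (h𝔪 : 𝔪 ≠ ⊥) (hray : ArtinKillsRay 𝔪 f)
        (hsep : ∀ χ : AddChar (Additive G) ℂ, χ ≠ 0 →
          ∃ v : HeightOneSpectrum (𝓞 K), ¬ 𝔪 ≤ v.asIdeal ∧ χ (Additive.ofMul (f v)) ≠ 1),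
        ∀ P : ℝ, 2 ≤ P → ((NumberField.discr K).natAbs : ℝ) ≤ P → ((Ideal.absNorm 𝔪 : ℕ) : ℝ) ≤ P →
          (Nat.card G : ℝ) ≤ P → P⁻¹ ≤ dedekindZeta_residue K →
        ∀ Z : AddChar (Additive G) ℂ → Finset ℂ,
          (∀ ψ : AddChar (Additive G) ℂ, ψ ≠ 0 → ∀ ρ ∈ Z ψ,
              datumL h𝔪 hray hsep ψ ρ = 0 ∧ 0 < ρ.re ∧ ρ.re < 1 ∧ |ρ.im| ≤ P) →
          ∀ α : ℝ, c₀ / Real.log P ≤ 1 - α → 1 - α ≤ δ₀ →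
            ∑ ψ : AddChar (Additive G) ℂ with ψ ≠ 0,
              ∑ ρ ∈ Z ψ with α ≤ ρ.re, (zeroOrder (datumL h𝔪 hray hsep ψ) ρ : ℝ) ≤ C * P ^ (A * (1 - α)) := by
  obtain ⟨A₀, r₀, C_z, hA₀, hr₀, hC_z, hZS⟩ := zeroSide_rayClass_of_le n
  obtain ⟨D, C_M, hDpos, hC_Mpos, hSV⟩ := card_mul_rayMeanValueConst_wide_le_param n
  have hn0 : (0 : ℝ) ≤ n := Nat.cast_nonneg n
  set a : ℝ := expoB with ha
  have hapos : 0 < a := expoB_pos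
  have ha1 : a ≤ 1 / 2 := expoB_le_half
  set B : ℝ := max (3888000 * ((n : ℝ) + 1) ^ 2) (max 8 (1 / (2 * c₀))) with hB
  have hB0 : 3888000 * ((n : ℝ) + 1) ^ 2 ≤ B := le_max_left _ _
  have hB8 : 8 ≤ B := (le_max_left _ _).trans (le_max_right _ _)
  have hBc : 1 / (2 * c₀) ≤ B := (le_max_right _ _).trans (le_max_right _ _)
  have hBpos : 0 < B := by linarith
  set A₁ : ℝ := max A₀ ((D + 2200) / (a * B)) with hA₁
  have hA₁pos : 0 < A₁ := lt_of_lt_of_le hA₀ (le_max_left _ _)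
  have hA₁A₀ : A₀ ≤ A₁ := le_max_left _ _
  have hA₁a : (D + 2200) / (a * B) ≤ A₁ := le_max_right _ _
  set K₁ : ℝ := 256 * π * C_z * C_M * A₁ ^ 2 * B ^ 3 with hK₁
  refine ⟨min (r₀ / 2) (1 / 2), (A₁ * B / 10 + 3) * 2, ((n : ℝ) + 1) ^ 2 * (K₁ * Real.exp 10),
    by positivity, by positivity, by positivity,
    fun K _ _ hnK G _ _ 𝔪 f h𝔪 hray hsep P hP hd hN𝔪 hh hκ Z hZ α hα1 hα2 => ?_⟩
  have hGpos : 0 < Nat.card G := Nat.card_pos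
  /- ── parameters ── -/
  have hPpos : 0 < P := by linarith
  set Lp : ℝ := Real.log P with hLp
  have hLp2 : Real.log 2 ≤ Lp := Real.log_le_log (by norm_num) hP
  have hlog2 : (0.69 : ℝ) ≤ Real.log 2 := by have := Real.log_two_gt_d9; linarith
  have hLppos : 0 < Lp := by linarith
  set r : ℝ := 2 * (1 - α) with hr
  have hδ : 1 - α ≤ r₀ / 2 := hα2.trans (min_le_left _ _)
  have hδ' : 1 - α ≤ 1 / 2 := hα2.trans (min_le_right _ _)
  have h1α : c₀ / Lp ≤ 1 - α := hα1
  have h1αpos : 0 < 1 - α := lt_of_lt_of_le (by positivity) h1α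
  have hrpos : 0 < r := by rw [hr]; linarith
  have hrr₀ : r ≤ r₀ := by rw [hr]; linarith
  have hr1 : r ≤ 1 := by rw [hr]; linarith
  set L' : ℝ := B * Lp with hL'
  have hL'8 : 8 * Lp ≤ L' := by rw [hL']; exact mul_le_mul_of_nonneg_right hB8 hLppos.le
  have hL'1 : 1 ≤ L' := by linarith
  have hu : 1 ≤ r * L' := by
    rw [hr, hL']
    have h1 : c₀ ≤ (1 - α) * Lp := by rwa [div_le_iff₀ hLppos] at h1α
    have h2 : 1 ≤ 2 * c₀ * B := by
      rw [div_le_iff₀ (by positivity)] at hBc; linarith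
    calc (1 : ℝ) ≤ 2 * c₀ * B := h2
      _ ≤ 2 * ((1 - α) * Lp) * B := by nlinarith only [h1, hBpos, hc₀]
      _ = 2 * (1 - α) * (B * Lp) := by ring
  set Lx : ℝ := A₁ * L' with hLx
  set x : ℝ := Real.exp Lx with hx
  have hxpos : 0 < x := Real.exp_pos _
  have hlogx : Real.log x = Lx := Real.log_exp _
  have hLxA₀ : A₀ * L' ≤ Real.log x := by
    rw [hlogx, hLx]; exact mul_le_mul_of_nonneg_right hA₁A₀ (by positivity)
  have haLxD : (D + 2200) * Lp ≤ a * Lx := by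
    rw [hLx, hL']
    have h1 : (D + 2200) / (a * B) * (B * Lp) ≤ A₁ * (B * Lp) :=
      mul_le_mul_of_nonneg_right hA₁a (by positivity)
    have h2 : a * ((D + 2200) / (a * B) * (B * Lp)) = (D + 2200) * Lp := by field_simp
    calc (D + 2200) * Lp = a * ((D + 2200) / (a * B) * (B * Lp)) := h2.symm
      _ ≤ a * (A₁ * (B * Lp)) := mul_le_mul_of_nonneg_left h1 hapos.le
  have hDLp : 0 ≤ D * Lp := by positivity
  have h2200Lp : 0 ≤ 2200 * Lp := by positivity
  have hDLx : D * Lp ≤ expoB * Lx := by rw [← ha]; linarith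
  have haLx : 2200 * Lp ≤ a * Lx := by linarith
  have haLx1500 : 1500 ≤ a * Lx := by linarith
  have hLxnn : 0 ≤ Lx := by rw [hLx]; positivity
  have hLx4 : 4 ≤ Lx := by nlinarith only [ha1, hLxnn, haLx1500, hapos]
  have hLx1 : 1 ≤ Lx := by linarith
  have hx1 : 1 ≤ x := by rw [hx]; exact Real.one_le_exp (by linarith)
  set T' : ℝ := P + 1 with hT'
  have hT'1 : 1 ≤ T' := by rw [hT']; linarith
  have hT'0 : 0 ≤ T' := by linarith
  have hT'pos : 0 < T' := by linarith
  have hT'2 : T' ≤ 2 * P := by rw [hT']; linarith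
  /- ── `NX = ⌊x^{a₀}⌋`, `z = ⌊NX^{1/(2n+4)}⌋` and the saving ── -/
  set NX : ℕ := ⌊x ^ a⌋₊ with hNX
  have hxa : x ^ a = Real.exp (a * Lx) := by rw [hx, ← Real.exp_mul, mul_comm]
  have hxa512 : (512 : ℝ) ≤ x ^ a := by
    rw [hxa]; linarith [Real.add_one_le_exp (a * Lx)]
  have hNXle : (NX : ℝ) ≤ x ^ a := Nat.floor_le (by positivity)
  have hNXgt : x ^ a < NX + 1 := Nat.lt_floor_add_one _
  have hNXhalf : x ^ a / 2 ≤ NX := by linarith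
  have hNX256 : (256 : ℝ) ≤ NX := by linarith
  have hNX1 : 1 ≤ NX := by exact_mod_cast (show (1 : ℝ) ≤ NX by linarith)
  have hNXpos : (0 : ℝ) < NX := by linarith
  set z : ℕ := ⌊(NX : ℝ) ^ (1 / (2 * (n : ℝ) + 4))⌋₊ with hz
  obtain ⟨hz1, hzNX, hzhalf, hPz, hM⟩ := hSV K hnK 𝔪 h𝔪 (Nat.card G) hGpos P T' Lx hP hd hN𝔪 hh hκ hT'1 hT'2 hDLx NX z
    hNXle hNXhalf hz
  have hmz : ((Ideal.absNorm 𝔪 : ℕ) : ℝ) ≤ z := hN𝔪.trans hPz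
  have hz1r : (1 : ℝ) ≤ z := by exact_mod_cast hz1
  /- ── kernel parameters `A = (n+2)T'`, `m = n + 3` ── -/
  set nK : ℕ := Module.finrank ℚ K with hnK'
  set m : ℕ := nK + 3 with hm
  have hm3 : Module.finrank ℚ K + 3 ≤ m := le_rfl
  have hnKn : (nK : ℝ) ≤ n := by exact_mod_cast hnK
  have hmcast : (m : ℝ) = nK + 3 := by rw [hm]; push_cast; ring
  set A : ℝ := ((n : ℝ) + 2) * T' with hAdef
  have hA : 0 < A := by positivity
  have hTA : ((m : ℝ) + 1) * T' ^ 2 ≤ 3 * A ^ 2 := by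
    rw [hmcast, hAdef]
    have hsq : 0 ≤ T' ^ 2 := sq_nonneg T'
    have hcoef : (nK : ℝ) + 3 + 1 ≤ 3 * ((n : ℝ) + 2) ^ 2 := by
      have hsq' : (0 : ℝ) ≤ (n : ℝ) ^ 2 := sq_nonneg _
      nlinarith only [hnKn, hn0, hsq']
    calc ((nK : ℝ) + 3 + 1) * T' ^ 2 ≤ (3 * ((n : ℝ) + 2) ^ 2) * T' ^ 2 := mul_le_mul_of_nonneg_right hcoef hsq
      _ = 3 * (((n : ℝ) + 2) * T') ^ 2 := by ring
  /- ── the sieve side for every `t ∈ (NX, x]` ── -/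
  set Bt : ℝ := 16 * π * C_M * Lx with hBt
  -- the sieve-side sums
  set J : AddChar (Additive G) ℂ → ℝ → ℝ → ℂ := fun ψ v t ↦
    ∑ I ∈ normIdeals K ((siftedSet x z).filter (fun n => n ≤ ⌊t⌋₊)),
      (((idealVonMangoldt I / (Module.finrank ℚ K * Ideal.absNorm I) : ℝ)) : ℂ) *
        ψ (Additive.ofMul (artinSymbol f I)) *
        Complex.exp (-(v * Real.log (Ideal.absNorm I)) * Complex.I) with hJ
  have hsieve : ∀ t ∈ Set.Ioc (NX : ℝ) x,
      ∑ ψ : AddChar (Additive G) ℂ, ∫ v in (-T')..T', ‖J ψ v t‖ ^ 2 ≤ Bt := by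
    intro t ht
    refine (sieveSide_congruence h𝔪 hray hsep x hz1 hzNX hmz hT'pos hA hm3 hTA t).trans ?_
    have h2 : ∑ n ∈ (siftedSet x z).filter (fun n => n ≤ ⌊t⌋₊), Λ n * Real.log n / n ≤ 2 * Lx ^ 2 := by
      have hsub : (siftedSet x z).filter (fun n => n ≤ ⌊t⌋₊) ⊆ Icc 1 ⌊x⌋₊ := by
        intro n hn
        rw [mem_filter] at hn
        obtain ⟨h1, h2, -⟩ := siftedSet_prop hn.1
        rw [mem_Icc]; omega
      refine (sum_le_sum_of_subset_of_nonneg hsub fun n _ _ => ?_).trans ?_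
      · exact div_nonneg (mul_nonneg ArithmeticFunction.vonMangoldt_nonneg (Real.log_natCast_nonneg n)) (Nat.cast_nonneg n)
      refine (sum_vonMangoldt_mul_log_div_le ⌊x⌋₊).trans ?_
      have hfl : Real.log ⌊x⌋₊ ≤ Lx := by
        rw [← hlogx]
        rcases Nat.eq_zero_or_pos ⌊x⌋₊ with h0 | hpos
        · rw [h0, Nat.cast_zero, Real.log_zero, hlogx]; linarith
        · exact Real.log_le_log (by exact_mod_cast hpos) (Nat.floor_le hxpos.le)
      have hfl0 : 0 ≤ Real.log ⌊x⌋₊ := Real.log_natCast_nonneg _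
      have hl4 : Real.log 4 ≤ 1.4 := by
        have h : Real.log 4 = 2 * Real.log 2 := by
          rw [show (4:ℝ) = 2 ^ 2 by norm_num, Real.log_pow]; norm_num
        rw [h]; have := Real.log_two_lt_d9; linarith
      have h5 : Real.log ⌊x⌋₊ * (Real.log ⌊x⌋₊ + Real.log 4 + 2) ≤ Lx * (Lx + 4) :=
        mul_le_mul hfl (by linarith) (by linarith [Real.log_nonneg (by norm_num : (1:ℝ) ≤ 4)]) hLxnn
      nlinarith only [h5, hLx4]
    have hnK1 : 1 / (Module.finrank ℚ K : ℝ) ≤ 1 := by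
      rw [div_le_one (by exact_mod_cast Module.finrank_pos (R := ℚ) (M := K))]
      exact_mod_cast Module.finrank_pos (R := ℚ) (M := K)
    have hsum0 : 0 ≤ ∑ n ∈ (siftedSet x z).filter (fun n => n ≤ ⌊t⌋₊), Λ n * Real.log n / n :=
      sum_nonneg fun n _ => div_nonneg (mul_nonneg ArithmeticFunction.vonMangoldt_nonneg (Real.log_natCast_nonneg n)) (Nat.cast_nonneg n)
    calc 8 * π * ((Nat.card G : ℝ) * rayMeanValueConst K 𝔪 h𝔪 (Nat.card G) A m z ⌊x ^ expoB⌋₊ *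
          (1 / (Module.finrank ℚ K : ℝ) * ∑ n ∈ (siftedSet x z).filter (fun n => n ≤ ⌊t⌋₊), Λ n * Real.log n / n))
        ≤ 8 * π * (C_M / Lx * (1 * (2 * Lx ^ 2))) := by
          rw [← ha, ← hNX]
          refine mul_le_mul_of_nonneg_left ?_ (by positivity)
          refine mul_le_mul hM (mul_le_mul hnK1 h2 hsum0 zero_le_one) (by positivity) (by positivity)
      _ = Bt := by rw [hBt]; field_simp; ring
  /- ── the zero side for every `ψ ≠ 0` ── -/
  have hnKpos : (0 : ℝ) < Module.finrank ℚ K := by exact_mod_cast Module.finrank_pos (R := ℚ) (M := K)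
  have hnpos : (0 : ℝ) < n := lt_of_lt_of_le hnKpos hnKn
  set L₀ : ℝ := Real.exp (-10) / (n : ℝ) ^ 2 * x ^ (-(r / 10)) / r ^ 3 with hL₀
  have hL₀pos : 0 < L₀ := by rw [hL₀]; positivity
  have hLL' : ∀ v : ℝ, |v| ≤ T' → rayLemmaAHeight K 𝔪 v ≤ L' := by
    intro v hv
    refine (rayLemmaAHeight_le_of_le hnK hP hd hN𝔪 h𝔪 (by rw [hT'] at hv; exact hv)).trans ?_
    rw [hL']; exact mul_le_mul_of_nonneg_right hB0 hLppos.le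
  -- the `t`-integrand of the sieve-side mean value and its integral
  set g : AddChar (Additive G) ℂ → ℝ → ℝ := fun ψ t => (∫ v in (-T')..T', ‖J ψ v t‖ ^ 2) / t with hg
  set F : AddChar (Additive G) ℂ → ℝ := fun ψ => ∫ t in Set.Ioc (NX : ℝ) x, g ψ t with hF
  have hNXx : (NX : ℝ) ≤ x := by
    refine hNXle.trans ?_
    exact Real.rpow_le_self_of_one_le hx1 (by linarith)
  -- per non-trivial character: identity of the sifted sums, Fubini, integrability
  have hiden : ∀ (ψ : AddChar (Additive G) ℂ) (hψ : ψ ≠ 0) (v t : ℝ),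
      summatory (coefSiftedB ((datumData h𝔪 hray hsep ψ hψ).coefB v) x z) t = J ψ v t := by
    intro ψ hψ v t
    rw [hJ]
    exact summatory_coefSiftedB_eq_sum_normIdeals h𝔪 ψ (datumData h𝔪 hray hsep ψ hψ) v x hmz t
  have hFeq : ∀ (ψ : AddChar (Additive G) ℂ) (hψ : ψ ≠ 0),
      ∫ v in (-T')..T', (datumData h𝔪 hray hsep ψ hψ).meanValue x z v = F ψ := by
    intro ψ hψ
    rw [(datumData h𝔪 hray hsep ψ hψ).integral_meanValue_eq x z hNX1 hT'0, hF, hg]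
    simp_rw [hiden ψ hψ]
    rw [← ha, ← hNX]
  have hgi : ∀ (ψ : AddChar (Additive G) ℂ) (hψ : ψ ≠ 0), IntegrableOn (g ψ) (Set.Ioc (NX : ℝ) x) := by
    intro ψ hψ
    have h := (datumData h𝔪 hray hsep ψ hψ).integrableOn_inner_CG x z hNX1 hT'0
    refine h.congr_fun (fun t _ ↦ ?_) measurableSet_Ioc
    rw [hg]; simp_rw [hiden ψ hψ]
  have hzero : ∀ ψ : AddChar (Additive G) ℂ, ψ ≠ 0 →
      r * L₀ * ∑ ρ ∈ Z ψ with α ≤ ρ.re, (zeroOrder (datumL h𝔪 hray hsep ψ) ρ : ℝ) ≤ C_z * (r * L') * F ψ := by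
    intro ψ hψ
    set Dψ := datumData h𝔪 hray hsep ψ hψ with hDψ
    rw [datumL_eq h𝔪 hray hsep hψ, ← hFeq ψ hψ]
    refine hZS K 𝔪 (charFun f ψ) Dψ (hsep ψ hψ) hnK T' r L' x z _ hLL' hrpos hrr₀ hu hx1 hLxA₀ hzhalf hT'0 ?_
    intro ρ hρ
    rw [mem_filter] at hρ
    obtain ⟨h0, -, hre1, him⟩ := hZ ψ hψ ρ hρ.1
    rw [datumL_eq h𝔪 hray hsep hψ] at h0
    refine ⟨h0, by rw [hr]; linarith [hρ.2], hre1, ?_⟩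
    rw [hT', hr]; linarith
  /- ── summing over `ψ` ── -/
  set S : ℝ := ∑ ψ : AddChar (Additive G) ℂ with ψ ≠ 0,
      ∑ ρ ∈ Z ψ with α ≤ ρ.re, (zeroOrder (datumL h𝔪 hray hsep ψ) ρ : ℝ) with hS
  set Ψ := (univ : Finset (AddChar (Additive G) ℂ)).filter (fun ψ => ψ ≠ 0) with hΨ
  have hstep1 : r * L₀ * S ≤ C_z * (r * L') * ∑ ψ ∈ Ψ, F ψ := by
    rw [hS, mul_sum, mul_sum]
    refine sum_le_sum fun ψ hψ => ?_
    rw [hΨ, mem_filter] at hψ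
    exact hzero ψ hψ.2
  -- Fubini and the sieve bound
  have hg0 : ∀ ψ t, t ∈ Set.Ioc (NX : ℝ) x → 0 ≤ g ψ t := by
    intro ψ t ht
    rw [hg]
    exact div_nonneg (intervalIntegral.integral_nonneg (by linarith) fun v _ => by positivity) (hNXpos.trans ht.1).le
  have hstep3 : ∑ ψ ∈ Ψ, F ψ ≤ Bt * Lx := by
    have hgiΨ : ∀ ψ ∈ Ψ, IntegrableOn (g ψ) (Set.Ioc (NX : ℝ) x) := by
      intro ψ hψ; rw [hΨ, mem_filter] at hψ; exact hgi ψ hψ.2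
    rw [hF]
    rw [← integral_finsetSum _ hgiΨ]
    have hBtint : IntegrableOn (fun t : ℝ => Bt * t⁻¹) (Set.Ioc (NX : ℝ) x) := by
      refine ((continuousOn_const.mul (continuousOn_inv₀.mono ?_)).integrableOn_compact isCompact_Icc).mono_set
        Set.Ioc_subset_Icc_self
      intro t ht; exact (hNXpos.trans_le ht.1).ne'
    calc ∫ t in Set.Ioc (NX : ℝ) x, ∑ ψ ∈ Ψ, g ψ t
        ≤ ∫ t in Set.Ioc (NX : ℝ) x, Bt * t⁻¹ := by
          refine setIntegral_mono_on (integrable_finsetSum _ hgiΨ)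
            hBtint measurableSet_Ioc fun t ht => ?_
          have ht0 : 0 < t := hNXpos.trans ht.1
          have h1 := hsieve t ht
          have h2 : ∑ ψ : AddChar (Additive G) ℂ, g ψ t =
              (∑ ψ : AddChar (Additive G) ℂ, ∫ v in (-T')..T', ‖J ψ v t‖ ^ 2) / t := by
            rw [hg, sum_div]
          have h3 : ∑ ψ ∈ Ψ, g ψ t ≤ ∑ ψ : AddChar (Additive G) ℂ, g ψ t :=
            sum_le_sum_of_subset_of_nonneg (filter_subset _ _) fun ψ _ _ => hg0 ψ t ht
          refine h3.trans ?_
          rw [h2, div_eq_mul_inv]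
          exact mul_le_mul_of_nonneg_right h1 (inv_nonneg.2 ht0.le)
      _ = Bt * Real.log (x / NX) := by
          rw [integral_const_mul, ← intervalIntegral.integral_of_le hNXx, integral_inv_of_pos hNXpos hxpos]
      _ ≤ Bt * Lx := by
          refine mul_le_mul_of_nonneg_left ?_ (by positivity)
          rw [Real.log_div hxpos.ne' hNXpos.ne', hlogx]
          linarith [Real.log_nonneg (show (1:ℝ) ≤ NX by exact_mod_cast hNX1)]
  have hmain := hstep1.trans (mul_le_mul_of_nonneg_left hstep3 (by positivity))
  /- ── the final arithmetic ── -/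
  -- `C_z (rL') (Bt Lx) = r (256π C_z C_M A₁² B³) Lp³ / 16 · 16`: we bound `L₀ ≥ e^{-10} x^{-r/10}/(16 r³)`
  have hK : C_z * (r * L') * (Bt * Lx) = r * (K₁ * Lp ^ 3) / 16 := by
    rw [hBt, hLx, hL', hK₁]; field_simp; ring
  rw [hK] at hmain
  -- divide by `r L₀`, `L₀ = L₁/n²`
  set L₁ : ℝ := Real.exp (-10) * x ^ (-(r / 10)) / r ^ 3 with hL₁
  have hL₁pos : 0 < L₁ := by positivity
  have hL₀eq : L₀ = L₁ / (n : ℝ) ^ 2 := by rw [hL₀, hL₁]; field_simp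
  have hS0 : 0 ≤ S := by
    rw [hS]; exact sum_nonneg fun ψ _ => sum_nonneg fun ρ _ => Nat.cast_nonneg _
  have hdiv : S ≤ (n : ℝ) ^ 2 * (K₁ * Lp ^ 3) / L₁ := by
    have h1 : r * (L₁ / (n : ℝ) ^ 2 * S) ≤ r * (K₁ * Lp ^ 3) := by
      have h16 : r * (K₁ * Lp ^ 3) / 16 ≤ r * (K₁ * Lp ^ 3) := by
        have : 0 ≤ r * (K₁ * Lp ^ 3) := by positivity
        linarith
      calc r * (L₁ / (n : ℝ) ^ 2 * S) = r * L₀ * S := by rw [hL₀eq]; ring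
        _ ≤ r * (K₁ * Lp ^ 3) / 16 := hmain
        _ ≤ r * (K₁ * Lp ^ 3) := h16
    have h2 := le_of_mul_le_mul_left h1 hrpos
    rw [le_div_iff₀ hL₁pos]
    have h3 : L₁ / (n : ℝ) ^ 2 * S * (n : ℝ) ^ 2 = S * L₁ := by field_simp
    have h4 := mul_le_mul_of_nonneg_right h2 (show (0 : ℝ) ≤ (n : ℝ) ^ 2 by positivity)
    rw [h3] at h4
    linarith
  refine hdiv.trans ?_
  have hxr : x ^ (r / 10) = Real.exp (A₁ * B / 10 * r * Lp) := by
    rw [hx, ← Real.exp_mul, hLx, hL']; ring_nf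
  have hL₁eq : K₁ * Lp ^ 3 / L₁ = K₁ * Real.exp 10 * ((r * Lp) ^ 3 * x ^ (r / 10)) := by
    rw [hL₁, Real.rpow_neg hxpos.le, Real.exp_neg]
    have hx10 : 0 < x ^ (r / 10) := by positivity
    field_simp
  rw [mul_div_assoc, hL₁eq]
  have hcube : (r * Lp) ^ 3 ≤ Real.exp (3 * (r * Lp)) := cube_le_exp (by positivity)
  have hPpow : P ^ ((A₁ * B / 10 + 3) * 2 * (1 - α)) =
      Real.exp (3 * (r * Lp)) * Real.exp (A₁ * B / 10 * r * Lp) := by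
    rw [Real.rpow_def_of_pos hPpos, ← Real.exp_add, ← hLp, hr]; ring_nf
  rw [hPpow, hxr]
  have hn1 : (n : ℝ) ^ 2 ≤ ((n : ℝ) + 1) ^ 2 := pow_le_pow_left₀ hn0 (by linarith) 2
  have hrest : K₁ * Real.exp 10 * ((r * Lp) ^ 3 * Real.exp (A₁ * B / 10 * r * Lp)) ≤
      K₁ * Real.exp 10 * (Real.exp (3 * (r * Lp)) * Real.exp (A₁ * B / 10 * r * Lp)) :=
    mul_le_mul_of_nonneg_left (mul_le_mul_of_nonneg_right hcube (Real.exp_pos _).le) (by positivity)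
  calc (n : ℝ) ^ 2 * (K₁ * Real.exp 10 * ((r * Lp) ^ 3 * Real.exp (A₁ * B / 10 * r * Lp)))
      ≤ ((n : ℝ) + 1) ^ 2 * (K₁ * Real.exp 10 * (Real.exp (3 * (r * Lp)) * Real.exp (A₁ * B / 10 * r * Lp))) :=
        mul_le_mul hn1 hrest (by positivity) (by positivity)
    _ = ((n : ℝ) + 1) ^ 2 * (K₁ * Real.exp 10) * (Real.exp (3 * (r * Lp)) * Real.exp (A₁ * B / 10 * r * Lp)) := by
        ring

end Literature.NumberTheory.LFunctions.AbelianDensity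

end
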